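import Summits.QuantumFields.BalabanUV.Beta.GAN24.LegRowsOnRuledClass
import Summits.QuantumFields.BalabanUV.Beta.GAN24.LegSlotDivergenceCommute

/-!
# `BalabanUV.Beta.GAN24.LegSourceRuledClass` — binder row G-an2-4 ∕ (CONV-C), W-slot, the (α-0) parity re-cut, row L11 (Q-L): **THE SOURCE LEG LETTERS OF THE
# `ε`-MEMBER ARE IN THE RULED CLASS, AND SO ARE THE DRIFT SOCKET's DIFFERENCE SOURCES** — the class rows (HSP) of FILE 1 `LegTowerWindowSources` and `hSP` of FILE 2
# `LegTowerWindowDriftSources` DISCHARGED at the parity member of the dressed comb tower (G-an2-4 formalisation swarm, leaf prover `b2b-balaban-gan24-formalise-leaf-03`,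
# gen 68; FILE 3 of the journal INTENT [LEAF03-G68-ONLINE] «(H2) ⟸ THE SAME WINDOWS»; continues MY `GAN24/LegRowsOnRuledClass` (gen 67, FILE 8b))

NOT IN PRINT; OUR BOOKKEEPING ([folklore] covariance ∕ zero-mode ∕ locality bookkeeping BY NAME: an2–leaf-01's `T2DevCovariance.source_comb_dressed_translate`, the OWNER's
`BiTableParityHalves.covariant_half ∕ locStencil₂_half` and `LegLetterZeroMode.zmode_rdiv_eq_zero`, leaf-18's `Lin4ZeroMode.locStencil₂_lin4` and
`DressedStepCharge.lin4_dressed_translate`, leaf-01's `WSlotFirstDiff.zmode_add ∕ zmode_sub`, MY g60 `rdiv_lin4_affine`, MY FILE 8b `legLetter_mem_ruledClass`; 0 `def`,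
0 cited facts, 0 `def … : Prop`, 0 sorry).  HONEST FRAMING (cell contract, verbatim): «discharging `BetaPertH` makes Bałaban's UV stability UNCONDITIONAL — a real
constructive-QFT result; it is NOT the continuum limit and NOT the Clay problem.»  HONEST DEPENDENCY (verbatim): «continuum YM on T⁴ ⇐ BetaPertH ∧ nine spine estimates
(0/9 proved); BetaPertH ⇐ (D1) ∧ (D4) ∧ CAP+tail; G-an2-4 gates asym, D1 and NE2/3/4.»

WHY.  FILE 1 ∕ FILE 2 of this gen unpack the (Q-L) END's window-source rows (H2) ∕ (H2d) into the SHORT WINDOWS (H1w) (asked, like (H1♮), only on the RULED CLASS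
`𝒫 = jointly Lc-covariant ∧ zero-mode-free ∧ LocStencil₂`) applied to the SOURCE leg letters `rdiv ∘ F^ε_n` (resp. to the difference sources
`(legStepB (l+1) − legStepB l)(rdiv ∘ y_l) + (rdiv ∘ F^ε_{l+1} − rdiv ∘ F^ε_l)`), so the sockets now carry the class rows (HSP) `𝒫 (rdiv ∘ F^ε_n)` and `hSP`.  This file
discharges both at the parity member `y_l = ½•(T̃_l + ε•P T̃_l)` of the dressed comb tower (`|ε| ≤ 1`; border covariance `hBt` displayed as in every END):
* §1 `ruledClass_add`, `ruledClass_sub` (𝒫 is closed under `±`: `add∕sub_translate_pi`, `zmode_add∕zmode_sub` at the smaller rate, `locStencil₂_add∕_sub`);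
  `legStepB_rdiv_eq` (`legStepB … j (rdiv ∘ y) = rdiv ∘ (𝒜^E_j y)` for bounded `y` — MY g60 `rdiv_lin4_affine` with zero source and g58's comb Ward laws);
  **`legStepB_rdiv_mem`** (for a jointly covariant `LocStencil₂` table `y`, `legStepB … j (rdiv ∘ y) ∈ 𝒫` at EVERY step `j` — `lin4_dressed_translate` ⨾ `locStencil₂_lin4` ⨾ FILE 8b's
  `legLetter_mem_ruledClass`).
* §2 **`halfSource_translate`** (the `ε`-member's source `F^ε_l = ½•(b̃_l + ε•P b̃_l)` is jointly `Lc`-covariant: `source_comb_dressed_translate` ⨾ `covariant_half`),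
  `exists_locStencil₂_source_comb` ∕ `exists_locStencil₂_halfSource` (it is `LocStencil₂` at some positive rate, level by level: `b̃_l = T̃_{l+1} − 𝒜^E_l T̃_l`),
  **`halfSource_legLetter_mem`** — (HSP): `𝒫 (rdiv ∘ F^ε_l)` at every level, hypothesis-free but for the border rows; `locStencil₂_rdiv_half` (raw letter row ⟹ (HS) row).
* §3 **`halfDiffSource_mem`** (the sum) and, separately, **`halfKernelDrift_mem`** (FILE 2's `hKP`) ∕ **`halfSourceDrift_mem`** (FILE 2's `hSP`): `𝒫 ((legStepB (l+1) − legStepB l)(rdiv ∘ y_l) + (rdiv ∘ F^ε_{l+1} − rdiv ∘ F^ε_l))` at every level (§1 closure + `legStepB_rdiv_mem` twice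
  on the member (jointly covariant by FILE 8b's `halfMember_translate`, `LocStencil₂` by leaf-01's `exists_locStencil₂_unitS₂_T2RecAt` ⨾ `locStencil₂_half`) + §2 twice).
Asserts NO bound uniform in the level (the uniform source ROWS (HS)∕(HS′) stay displayed in FILE 4); discharges NOTHING of (Q-L) ∕ (C) ∕ «T2Shape» ∕ «T2Drift» ∕ (hW, hWall);
NEVER «G-an2-4 closed» as (CONV-C); NOT D1, NOT `BetaPertH`, NOT continuum, NOT Clay; not in print.  Unit `b2b-balaban-gan24-formalise-leaf-03` (gen 68), 2026-08-23.
-/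

noncomputable section
open Finset
open scoped BigOperators
open Literature.MathematicalPhysics.QuantumFieldTheory
open Literature.MathematicalPhysics.QuantumFieldTheory.Balaban1983to89
open Literature.MathematicalPhysics.QuantumFieldTheory.Balaban1983to89.Beta
open ExpKernelCalculus (MKer Site Decays shiftK)
open OneStepResolventKernel (Fib LocStencil)
open OneStepKernelFamily (KInvStep)
open AffineAveraging (box toSite unitVec)
open AveragingMixedJetTables (mixFFAt)
open SecondOrderResponse (W2SymOfK)
open BalabanCompositeJets (LocStencil₂ LocStencil₂.mono)
open BalabanStepJetsSucc (mmRead)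
open BalabanStepW2 (K3OfK M2Of)
open Summit.QuantumFields.BalabanUV.Beta.TameKernelCalculus (trK)
open Summit.QuantumFields.BalabanUV.Beta.BorderedHessian (sgnK)
open Summit.QuantumFields.BalabanUV.Beta.HessKerDressedUnits (unitK unitS decays_unitK)
open Summit.QuantumFields.BalabanUV.Beta.SecondOrderUnits (unitM unitS₂ unitM₂)
open Summit.QuantumFields.BalabanUV.Beta.AxialDressingRooted (coDressKBmAt one_le_of_neZero decays_coDressKBmAt_KInvStep)
open Summit.QuantumFields.BalabanUV.Beta.SpineRooted (T2RecAt SpureRecAt M1At)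
open Summit.QuantumFields.BalabanUV.Beta.GAN24.CombesThomas (sfStep smStep)
open Summit.QuantumFields.BalabanUV.Beta.GAN24.T2RecursionAffine (lin4)
open Summit.QuantumFields.BalabanUV.Beta.GAN24.BiStencilZeroMode (zmode)
open Summit.QuantumFields.BalabanUV.Beta.GAN24.Lin4SlotDivergence (hH_unitK_comb)
open Summit.QuantumFields.BalabanUV.Beta.GAN24.Lin4LegDivergence (hM_unitK_comb)
open Summit.QuantumFields.BalabanUV.Beta.GAN24.Lin4LegTower (rdiv rdiv_lin4_affine)
open Summit.QuantumFields.BalabanUV.Beta.GAN24.Lin4LegTowerUnroll (legStepB)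
open Summit.QuantumFields.BalabanUV.Beta.GAN24.T2UnitSplitShapes (bdd₄_of_locStencil₂)
open Summit.QuantumFields.BalabanUV.Beta.GAN24.T2HybridCellsComb (exists_locStencil₂_unitS₂_T2RecAt)
open Summit.QuantumFields.BalabanUV.Beta.GAN24.T2DevCovariance (unitS₂_T2RecAt_translate succ_comb_dressed source_comb_dressed_translate)
open Summit.QuantumFields.BalabanUV.Beta.GAN24.BiTableParityHalves (covariant_half locStencil₂_half)
open Summit.QuantumFields.BalabanUV.Beta.GAN24.WSlotFirstDiff (zmode_add zmode_sub)
open Summit.QuantumFields.BalabanUV.Beta.GAN24.WSlotT2OfPieces (locStencil₂_add)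
open Summit.QuantumFields.BalabanUV.Beta.GAN24.WSlotForcingZeroModeW3 (add_translate_pi sub_translate_pi)
open Summit.QuantumFields.BalabanUV.Beta.GAN24.Lin4ZeroMode (locStencil₂_lin4)
open Summit.QuantumFields.BalabanUV.Beta.GAN24.DressedStepCharge (lin4_dressed_translate)
open Summit.QuantumFields.BalabanUV.Beta.GAN24.LegFirstWindowRows (locStencil₂_sub locStencil₂_rdiv)
open Summit.QuantumFields.BalabanUV.Beta.GAN24.LegSlotDivergenceCommute (rdiv_zero)
open Summit.QuantumFields.BalabanUV.Beta.GAN24.LegRowsOnRuledClass (legLetter_mem_ruledClass halfMember_translate)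

namespace Summit.QuantumFields.BalabanUV.Beta.GAN24.LegSourceRuledClass

variable {d : ℕ} {Lc : ℕ}

/-! ## §1 The ruled class is closed under `±`; one dressed comb step keeps leg letters in it -/

/-- [folklore] **THE RULED CLASS IS CLOSED UNDER ADDITION** (covariance: leaf-18's `add_translate_pi`; zero modes: leaf-01's `zmode_add` at the smaller of the two rates;
`LocStencil₂`: `locStencil₂_add` at the smaller rate). -/
theorem ruledClass_add {A B : (Fin (d + 1) → (Fin (d + 1) → ℤ) → Fin (d + 1) → (Fin (d + 1) → ℤ) → MKer (d + 1) (Fib d))}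
    (hA : (fun W : (Fin (d + 1) → (Fin (d + 1) → ℤ) → Fin (d + 1) → (Fin (d + 1) → ℤ) → MKer (d + 1) (Fib d)) =>
      (∀ (κ : Fin (d + 1)) (u : Fin (d + 1) → ℤ) (κ' : Fin (d + 1)) (u' t : Fin (d + 1) → ℤ),
          W κ (u + (Lc : ℤ) • t) κ' (u' + (Lc : ℤ) • t) = shiftK (-((Lc : ℤ) • t)) (W κ u κ' u')) ∧
      (∀ (N' : ℕ) (κ κ' : Fin (d + 1)) (a b : Fib d), zmode N' W κ κ' a b = 0) ∧
      (∃ C' δ' : ℝ, 0 < δ' ∧ LocStencil₂ W C' δ')) A)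
    (hB : (fun W : (Fin (d + 1) → (Fin (d + 1) → ℤ) → Fin (d + 1) → (Fin (d + 1) → ℤ) → MKer (d + 1) (Fib d)) =>
      (∀ (κ : Fin (d + 1)) (u : Fin (d + 1) → ℤ) (κ' : Fin (d + 1)) (u' t : Fin (d + 1) → ℤ),
          W κ (u + (Lc : ℤ) • t) κ' (u' + (Lc : ℤ) • t) = shiftK (-((Lc : ℤ) • t)) (W κ u κ' u')) ∧
      (∀ (N' : ℕ) (κ κ' : Fin (d + 1)) (a b : Fib d), zmode N' W κ κ' a b = 0) ∧
      (∃ C' δ' : ℝ, 0 < δ' ∧ LocStencil₂ W C' δ')) B) :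
    (fun W : (Fin (d + 1) → (Fin (d + 1) → ℤ) → Fin (d + 1) → (Fin (d + 1) → ℤ) → MKer (d + 1) (Fib d)) =>
      (∀ (κ : Fin (d + 1)) (u : Fin (d + 1) → ℤ) (κ' : Fin (d + 1)) (u' t : Fin (d + 1) → ℤ),
          W κ (u + (Lc : ℤ) • t) κ' (u' + (Lc : ℤ) • t) = shiftK (-((Lc : ℤ) • t)) (W κ u κ' u')) ∧
      (∀ (N' : ℕ) (κ κ' : Fin (d + 1)) (a b : Fib d), zmode N' W κ κ' a b = 0) ∧
      (∃ C' δ' : ℝ, 0 < δ' ∧ LocStencil₂ W C' δ')) (A + B) := by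
  obtain ⟨hAc, hAz, CA, δA, hδA, hAl⟩ := hA
  obtain ⟨hBc, hBz, CB, δB, hδB, hBl⟩ := hB
  have hδ : 0 < min δA δB := lt_min hδA hδB
  refine ⟨fun κ u κ' u' t => add_translate_pi (w := (Lc : ℤ) • t) (v := -((Lc : ℤ) • t)) (fun κ u κ' u' => hAc κ u κ' u' t) (fun κ u κ' u' => hBc κ u κ' u' t) κ u κ' u',
    fun N' κ κ' a b => ?_, ⟨CA + CB, min δA δB, hδ, locStencil₂_add (hAl.mono (min_le_left _ _)) (hBl.mono (min_le_right _ _))⟩⟩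
  have h := zmode_add (N := N') (hAl.mono (min_le_left δA δB)) (hBl.mono (min_le_right δA δB)) hδ κ κ' a b
  rw [hAz, hBz, add_zero] at h
  exact h

/-- [folklore] **THE RULED CLASS IS CLOSED UNDER SUBTRACTION** (`sub_translate_pi`, `zmode_sub`, `locStencil₂_sub`). -/
theorem ruledClass_sub {A B : (Fin (d + 1) → (Fin (d + 1) → ℤ) → Fin (d + 1) → (Fin (d + 1) → ℤ) → MKer (d + 1) (Fib d))}
    (hA : (fun W : (Fin (d + 1) → (Fin (d + 1) → ℤ) → Fin (d + 1) → (Fin (d + 1) → ℤ) → MKer (d + 1) (Fib d)) =>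
      (∀ (κ : Fin (d + 1)) (u : Fin (d + 1) → ℤ) (κ' : Fin (d + 1)) (u' t : Fin (d + 1) → ℤ),
          W κ (u + (Lc : ℤ) • t) κ' (u' + (Lc : ℤ) • t) = shiftK (-((Lc : ℤ) • t)) (W κ u κ' u')) ∧
      (∀ (N' : ℕ) (κ κ' : Fin (d + 1)) (a b : Fib d), zmode N' W κ κ' a b = 0) ∧
      (∃ C' δ' : ℝ, 0 < δ' ∧ LocStencil₂ W C' δ')) A)
    (hB : (fun W : (Fin (d + 1) → (Fin (d + 1) → ℤ) → Fin (d + 1) → (Fin (d + 1) → ℤ) → MKer (d + 1) (Fib d)) =>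
      (∀ (κ : Fin (d + 1)) (u : Fin (d + 1) → ℤ) (κ' : Fin (d + 1)) (u' t : Fin (d + 1) → ℤ),
          W κ (u + (Lc : ℤ) • t) κ' (u' + (Lc : ℤ) • t) = shiftK (-((Lc : ℤ) • t)) (W κ u κ' u')) ∧
      (∀ (N' : ℕ) (κ κ' : Fin (d + 1)) (a b : Fib d), zmode N' W κ κ' a b = 0) ∧
      (∃ C' δ' : ℝ, 0 < δ' ∧ LocStencil₂ W C' δ')) B) :
    (fun W : (Fin (d + 1) → (Fin (d + 1) → ℤ) → Fin (d + 1) → (Fin (d + 1) → ℤ) → MKer (d + 1) (Fib d)) =>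
      (∀ (κ : Fin (d + 1)) (u : Fin (d + 1) → ℤ) (κ' : Fin (d + 1)) (u' t : Fin (d + 1) → ℤ),
          W κ (u + (Lc : ℤ) • t) κ' (u' + (Lc : ℤ) • t) = shiftK (-((Lc : ℤ) • t)) (W κ u κ' u')) ∧
      (∀ (N' : ℕ) (κ κ' : Fin (d + 1)) (a b : Fib d), zmode N' W κ κ' a b = 0) ∧
      (∃ C' δ' : ℝ, 0 < δ' ∧ LocStencil₂ W C' δ')) (A - B) := by
  obtain ⟨hAc, hAz, CA, δA, hδA, hAl⟩ := hA
  obtain ⟨hBc, hBz, CB, δB, hδB, hBl⟩ := hB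
  have hδ : 0 < min δA δB := lt_min hδA hδB
  refine ⟨fun κ u κ' u' t => sub_translate_pi (w := (Lc : ℤ) • t) (v := -((Lc : ℤ) • t)) (fun κ u κ' u' => hAc κ u κ' u' t) (fun κ u κ' u' => hBc κ u κ' u' t) κ u κ' u',
    fun N' κ κ' a b => ?_, ⟨CA + CB, min δA δB, hδ, locStencil₂_sub (hAl.mono (min_le_left _ _)) (hBl.mono (min_le_right _ _))⟩⟩
  have h := zmode_sub (N := N') (hAl.mono (min_le_left δA δB)) (hBl.mono (min_le_right δA δB)) hδ κ κ' a b
  rw [hAz, hBz, sub_zero] at h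
  exact h

variable [NeZero Lc] {r : Fin (d + 1) → ℕ}

/-- [folklore] **ONE DRESSED COMB LEG STEP OF A LEG LETTER IS THE LEG LETTER OF THE ONE-STEP IMAGE**: for a bounded table `y` and every step `j`,
`legStepB (fun _ ↦ −(c·(Lc^{d+1})⁻¹)) K♮ᴱ Lc j (rdiv ∘ y) = rdiv ∘ (lin4 c K♮ᴱ_j Lc y)` (MY g60 `rdiv_lin4_affine` with zero source; g58's comb Ward laws
`hH_unitK_comb ∕ hM_unitK_comb`). -/
theorem legStepB_rdiv_eq (hr : r ∈ box (d + 1) Lc) (c : ℝ) (j : ℕ) {y : (Fin (d + 1) → (Fin (d + 1) → ℤ) → Fin (d + 1) → (Fin (d + 1) → ℤ) → MKer (d + 1) (Fib d))}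
    (hy : ∃ B : ℝ, ∀ κ u κ' u' x z a b, |y κ u κ' u' x z a b| ≤ B) :
    legStepB (fun _ : ℕ => -(c * ((Lc : ℝ) ^ (d + 1))⁻¹)) (fun m => unitK (sfStep Lc m) (smStep d Lc m) (coDressKBmAt (toSite r) Lc (KInvStep (d := d) Lc m))) Lc j (fun κ u κ' u' => rdiv (y κ u κ' u'))
      = fun κ u κ' u' => rdiv (lin4 c (unitK (sfStep Lc j) (smStep d Lc j) (coDressKBmAt (toSite r) Lc (KInvStep (d := d) Lc j))) Lc y κ u κ' u') := by
  obtain ⟨B, hBy⟩ := hy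
  obtain ⟨δK, CK, hδK, -, hG⟩ := decays_coDressKBmAt_KInvStep (d := d) hr j
  funext κ u κ' u'
  have h := rdiv_lin4_affine (decays_unitK (sf := sfStep Lc j) (sm := smStep d Lc j) hG) hδK (one_le_of_neZero Lc) c hBy (hH_unitK_comb hr j) (hM_unitK_comb j)
    (0 : (Fin (d + 1) → (Fin (d + 1) → ℤ) → Fin (d + 1) → (Fin (d + 1) → ℤ) → MKer (d + 1) (Fib d))) κ u κ' u'
  rw [add_zero] at h
  simp only [Pi.zero_apply, rdiv_zero, add_zero] at h
  exact h.symm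

/-- NOT IN PRINT; OUR BOOKKEEPING.  **ONE DRESSED COMB LEG STEP KEEPS THE LEG LETTER OF A COVARIANT `LocStencil₂` TABLE IN THE RULED CLASS, AT EVERY STEP `j`**
(also at a step MISMATCHED with the table's level — the kernel-drift letter of FILE 2 needs `j = l+1` on `y_l`): `legStepB … j (rdiv ∘ y) = rdiv ∘ (𝒜^E_j y)` and `𝒜^E_j y` is
jointly covariant (`lin4_dressed_translate`) and `LocStencil₂` at a positive rate (`locStencil₂_lin4`), so FILE 8b's `legLetter_mem_ruledClass` applies. -/
theorem legStepB_rdiv_mem (hr : r ∈ box (d + 1) Lc) (c : ℝ) (j : ℕ) {y : (Fin (d + 1) → (Fin (d + 1) → ℤ) → Fin (d + 1) → (Fin (d + 1) → ℤ) → MKer (d + 1) (Fib d))}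
    (hyc : ∀ κ u κ' u' t, y κ (u + (Lc : ℤ) • t) κ' (u' + (Lc : ℤ) • t) = shiftK (-((Lc : ℤ) • t)) (y κ u κ' u'))
    {C δ : ℝ} (hyl : LocStencil₂ y C δ) (hδ : 0 < δ) :
    (fun W : (Fin (d + 1) → (Fin (d + 1) → ℤ) → Fin (d + 1) → (Fin (d + 1) → ℤ) → MKer (d + 1) (Fib d)) =>
      (∀ (κ : Fin (d + 1)) (u : Fin (d + 1) → ℤ) (κ' : Fin (d + 1)) (u' t : Fin (d + 1) → ℤ),
          W κ (u + (Lc : ℤ) • t) κ' (u' + (Lc : ℤ) • t) = shiftK (-((Lc : ℤ) • t)) (W κ u κ' u')) ∧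
      (∀ (N' : ℕ) (κ κ' : Fin (d + 1)) (a b : Fib d), zmode N' W κ κ' a b = 0) ∧
      (∃ C' δ' : ℝ, 0 < δ' ∧ LocStencil₂ W C' δ'))
      (legStepB (fun _ : ℕ => -(c * ((Lc : ℝ) ^ (d + 1))⁻¹)) (fun m => unitK (sfStep Lc m) (smStep d Lc m) (coDressKBmAt (toSite r) Lc (KInvStep (d := d) Lc m))) Lc j (fun κ u κ' u' => rdiv (y κ u κ' u'))) := by
  obtain ⟨δK, CK, hδK, hCK, hG⟩ := decays_coDressKBmAt_KInvStep (d := d) hr j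
  have hA := locStencil₂_lin4 (decays_unitK (sf := sfStep Lc j) (sm := smStep d Lc j) hG) (by positivity) hδK (one_le_of_neZero Lc) c hyl hδ
  rw [legStepB_rdiv_eq hr c j (bdd₄_of_locStencil₂ hyl hδ.le)]
  exact legLetter_mem_ruledClass (fun κ u κ' u' t => lin4_dressed_translate (toSite r) j c hyc κ u κ' u' ((Lc : ℤ) • t)) hA (by positivity)

/-! ## §2 The `ε`-member's sources: covariant, `LocStencil₂`, leg letters in the ruled class -/

/-- [folklore] **THE `ε`-MEMBER's SOURCE `F^ε_l = ½•(b̃_l + ε•P b̃_l)` IS JOINTLY `Lc`-COVARIANT** (an2–leaf-01's `source_comb_dressed_translate` ⨾ the OWNER's `covariant_half`;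
border rows displayed). -/
theorem halfSource_translate (hLc : 1 ≤ Lc) (hr : r ∈ box (d + 1) Lc) (cE cVH cΛ cE₂ cB : ℝ) (Tc : Fin 4 → Fin 4 → Fin 4 → Fin 4 → ℝ) {vh₂S : (Fin (d + 1) → (Fin (d + 1) → ℤ) → Fin (d + 1) → (Fin (d + 1) → ℤ) → MKer (d + 1) (Fib d))}
    (hBff : ∀ κ u κ' u' x z (α β : Fin (d + 1)), vh₂S κ u κ' u' x z (Sum.inl α) (Sum.inl β) = 0)
    (hBmm : ∀ κ u κ' u' x z (μ ν : Fin (d + 1)), vh₂S κ u κ' u' x z (Sum.inr μ) (Sum.inr ν) = 0)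
    (hB : ∃ C δ : ℝ, 0 < δ ∧ LocStencil₂ vh₂S C δ)
    (hBt : ∀ (κ : Fin (d + 1)) (u : Fin (d + 1) → ℤ) (κ' : Fin (d + 1)) (u' t : Fin (d + 1) → ℤ),
        vh₂S κ (u + (Lc : ℤ) • t) κ' (u' + (Lc : ℤ) • t) = shiftK (-((Lc : ℤ) • t)) (vh₂S κ u κ' u')) (ε : ℝ) (l : ℕ)
    (κ : Fin (d + 1)) (u : Fin (d + 1) → ℤ) (κ' : Fin (d + 1)) (u' t : Fin (d + 1) → ℤ) :
    (((1 : ℝ) / 2) • ((fun κ u κ' u' => (cE₂ * (Lc : ℝ) ^ (2 * (d + 1))) • mmRead Lc (K3OfK (unitK (sfStep Lc l) (smStep d Lc l) (coDressKBmAt (toSite r) Lc (KInvStep (d := d) Lc l))) Lc (unitS (sfStep Lc l) (smStep d Lc l) (SpureRecAt d Lc (toSite r) cE cVH cΛ l)) (unitM (sfStep Lc l) (smStep d Lc l) (M1At d Lc (toSite r) cΛ l)) (W2SymOfK (unitK (sfStep Lc l) (smStep d Lc l) (coDressKBmAt (toSite r) Lc (KInvStep (d := d) Lc l))) Lc (unitS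 (sfStep Lc l) (smStep d Lc l) (SpureRecAt d Lc (toSite r) cE cVH cΛ l)) (unitM (sfStep Lc l) (smStep d Lc l) (M1At d Lc (toSite r) cΛ l)) 0 (unitM₂ (sfStep Lc l) (smStep d Lc l) (M2Of d Lc (mixFFAt (toSite r) Lc) l))) κ u κ' u') + cB • vh₂S κ u κ' u') + ε • fun κ u κ' u' => sgnK (trK (((fun κ u κ' u' => (cE₂ * (Lc : ℝ) ^ (2 * (d + 1))) • mmRead Lc (K3OfK (unitK (sfStep Lc l) (smStep d Lc l) (coDressKBmAt (toSite r) Lc (KInvStep (d := d) Lc l))) Lc (unitS (sfStep Lc l) (smStep d Lc l) (SpureRecAt d Lc (toSite r) cE cVH cΛ l)) (unitM (sfStep Lc l) (smStep d Lc l) (M1At d Lc (toSite r) cΛ l)) (W2SymOfK (unitK (sfStep Lc l) (smStep d Lc l) (coDressKBmAt (toSite r) Lc (KInvStep (d := d) Lc l))) Lc (unitS (sfStep Lc l) (smStep d Lc l) (SpureRecAt d Lc (toSite r) cE cVH cΛ l)) (unitM (sfStep Lc l) (smStep d Lc l) (M1At d Lc (toSite r) cΛ l)) 0 (unitM₂ (sfStep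 Lc l) (smStep d Lc l) (M2Of d Lc (mixFFAt (toSite r) Lc) l))) κ u κ' u') + cB • vh₂S κ u κ' u')) κ u κ' u')))) κ (u + (Lc : ℤ) • t) κ' (u' + (Lc : ℤ) • t)
      = shiftK (-((Lc : ℤ) • t)) ((((1 : ℝ) / 2) • ((fun κ u κ' u' => (cE₂ * (Lc : ℝ) ^ (2 * (d + 1))) • mmRead Lc (K3OfK (unitK (sfStep Lc l) (smStep d Lc l) (coDressKBmAt (toSite r) Lc (KInvStep (d := d) Lc l))) Lc (unitS (sfStep Lc l) (smStep d Lc l) (SpureRecAt d Lc (toSite r) cE cVH cΛ l)) (unitM (sfStep Lc l) (smStep d Lc l) (M1At d Lc (toSite r) cΛ l)) (W2SymOfK (unitK (sfStep Lc l) (smStep d Lc l) (coDressKBmAt (toSite r) Lc (KInvStep (d := d) Lc l))) Lc (unitS (sfStep Lc l) (smStep d Lc l) (SpureRecAt d Lc (toSite r) cE cVH cΛ l)) (unitM (sfStep Lc l) (smStep d Lc l) (M1At d Lc (toSite r) cΛ l)) 0 (unitM₂ (sfStep Lc l) (smStep d Lc l) (M2Of d Lc (mixFFAt (toSite r) Lc)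 l))) κ u κ' u') + cB • vh₂S κ u κ' u') + ε • fun κ u κ' u' => sgnK (trK (((fun κ u κ' u' => (cE₂ * (Lc : ℝ) ^ (2 * (d + 1))) • mmRead Lc (K3OfK (unitK (sfStep Lc l) (smStep d Lc l) (coDressKBmAt (toSite r) Lc (KInvStep (d := d) Lc l))) Lc (unitS (sfStep Lc l) (smStep d Lc l) (SpureRecAt d Lc (toSite r) cE cVH cΛ l)) (unitM (sfStep Lc l) (smStep d Lc l) (M1At d Lc (toSite r) cΛ l)) (W2SymOfK (unitK (sfStep Lc l) (smStep d Lc l) (coDressKBmAt (toSite r) Lc (KInvStep (d := d) Lc l))) Lc (unitS (sfStep Lc l) (smStep d Lc l) (SpureRecAt d Lc (toSite r) cE cVH cΛ l)) (unitM (sfStep Lc l) (smStep d Lc l) (M1At d Lc (toSite r) cΛ l)) 0 (unitM₂ (sfStep Lc l) (smStep d Lc l) (M2Of d Lc (mixFFAt (toSite r) Lc) l))) κ u κ' u') + cB • vh₂S κ u κ' u')) κ u κ' u')))) κ u κ' u') :=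
  covariant_half (N := Lc) (T := (fun κ u κ' u' => (cE₂ * (Lc : ℝ) ^ (2 * (d + 1))) • mmRead Lc (K3OfK (unitK (sfStep Lc l) (smStep d Lc l) (coDressKBmAt (toSite r) Lc (KInvStep (d := d) Lc l))) Lc (unitS (sfStep Lc l) (smStep d Lc l) (SpureRecAt d Lc (toSite r) cE cVH cΛ l)) (unitM (sfStep Lc l) (smStep d Lc l) (M1At d Lc (toSite r) cΛ l)) (W2SymOfK (unitK (sfStep Lc l) (smStep d Lc l) (coDressKBmAt (toSite r) Lc (KInvStep (d := d) Lc l))) Lc (unitS (sfStep Lc l) (smStep d Lc l) (SpureRecAt d Lc (toSite r) cE cVH cΛ l)) (unitM (sfStep Lc l) (smStep d Lc l) (M1At d Lc (toSite r) cΛ l)) 0 (unitM₂ (sfStep Lc l) (smStep d Lc l) (M2Of d Lc (mixFFAt (toSite r) Lc) l))) κ u κ' u') + cB • vh₂S κ u κ' u'))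
    (fun κ u κ' u' t => source_comb_dressed_translate hLc hr cE cVH cΛ cE₂ cB Tc hBff hBmm hB hBt l κ u κ' u' t) ε κ u κ' u' t

/-- [folklore] **THE DRESSED SOURCE `b̃_l` IS `LocStencil₂` AT SOME POSITIVE RATE** (level by level: `b̃_l = T̃_{l+1} − 𝒜^E_l T̃_l` by `succ_comb_dressed`; both terms by leaf-01's
`exists_locStencil₂_unitS₂_T2RecAt` and leaf-18's `locStencil₂_lin4`). -/
theorem exists_locStencil₂_source_comb (hLc : 1 ≤ Lc) (hr : r ∈ box (d + 1) Lc) (cE cVH cΛ cE₂ cB : ℝ) (Tc : Fin 4 → Fin 4 → Fin 4 → Fin 4 → ℝ) {vh₂S : (Fin (d + 1) → (Fin (d + 1) → ℤ) → Fin (d + 1) → (Fin (d + 1) → ℤ) → MKer (d + 1) (Fib d))}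
    (hBff : ∀ κ u κ' u' x z (α β : Fin (d + 1)), vh₂S κ u κ' u' x z (Sum.inl α) (Sum.inl β) = 0)
    (hBmm : ∀ κ u κ' u' x z (μ ν : Fin (d + 1)), vh₂S κ u κ' u' x z (Sum.inr μ) (Sum.inr ν) = 0)
    (hB : ∃ C δ : ℝ, 0 < δ ∧ LocStencil₂ vh₂S C δ) (l : ℕ) :
    ∃ C δ : ℝ, 0 < δ ∧ LocStencil₂ (fun κ u κ' u' => (cE₂ * (Lc : ℝ) ^ (2 * (d + 1))) • mmRead Lc (K3OfK (unitK (sfStep Lc l) (smStep d Lc l) (coDressKBmAt (toSite r) Lc (KInvStep (d := d) Lc l))) Lc (unitS (sfStep Lc l) (smStep d Lc l) (SpureRecAt d Lc (toSite r) cE cVH cΛ l)) (unitM (sfStep Lc l) (smStep d Lc l) (M1At d Lc (toSite r) cΛ l)) (W2SymOfK (unitK (sfStep Lc l) (smStep d Lc l) (coDressKBmAt (toSite r) Lc (KInvStep (d := d) Lc l))) Lc (unitS (sfStep Lc l) (smStep d Lc l) (SpureRecAt d Lc (toSite r) cE cVH cΛ l)) (unitM (sfStep Lc l) (smStep d Lc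 l) (M1At d Lc (toSite r) cΛ l)) 0 (unitM₂ (sfStep Lc l) (smStep d Lc l) (M2Of d Lc (mixFFAt (toSite r) Lc) l))) κ u κ' u') + cB • vh₂S κ u κ' u') C δ := by
  obtain ⟨CT, δT, hδT, hT⟩ := exists_locStencil₂_unitS₂_T2RecAt hLc hr cE cVH cΛ cE₂ cB Tc hB l
  obtain ⟨CT', δT', hδT', hT'⟩ := exists_locStencil₂_unitS₂_T2RecAt hLc hr cE cVH cΛ cE₂ cB Tc hB (l + 1)
  obtain ⟨δK, CK, hδK, hCK, hG⟩ := decays_coDressKBmAt_KInvStep (d := d) hr l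
  have hA := locStencil₂_lin4 (decays_unitK (sf := sfStep Lc l) (sm := smStep d Lc l) hG) (by positivity) hδK (one_le_of_neZero Lc)
    (cE₂ * (Lc : ℝ) ^ (2 * (d + 1))) hT hδT
  have hrate : 0 < min δT' (min δK δT / 128) := by positivity
  have hsub := locStencil₂_sub (hT'.mono (min_le_left _ _)) (hA.mono (min_le_right _ _))
  rw [succ_comb_dressed hLc hr cE cVH cΛ cE₂ cB Tc hBff hBmm hB l, add_sub_cancel_left] at hsub
  exact ⟨_, _, hrate, hsub⟩

/-- [folklore] **THE `ε`-MEMBER's SOURCE IS `LocStencil₂` AT SOME POSITIVE RATE** (`|ε| ≤ 1`; the OWNER's `locStencil₂_half`). -/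
theorem exists_locStencil₂_halfSource (hLc : 1 ≤ Lc) (hr : r ∈ box (d + 1) Lc) (cE cVH cΛ cE₂ cB : ℝ) (Tc : Fin 4 → Fin 4 → Fin 4 → Fin 4 → ℝ) {vh₂S : (Fin (d + 1) → (Fin (d + 1) → ℤ) → Fin (d + 1) → (Fin (d + 1) → ℤ) → MKer (d + 1) (Fib d))}
    (hBff : ∀ κ u κ' u' x z (α β : Fin (d + 1)), vh₂S κ u κ' u' x z (Sum.inl α) (Sum.inl β) = 0)
    (hBmm : ∀ κ u κ' u' x z (μ ν : Fin (d + 1)), vh₂S κ u κ' u' x z (Sum.inr μ) (Sum.inr ν) = 0)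
    (hB : ∃ C δ : ℝ, 0 < δ ∧ LocStencil₂ vh₂S C δ) {ε : ℝ} (hε : |ε| ≤ 1) (l : ℕ) :
    ∃ C δ : ℝ, 0 < δ ∧ LocStencil₂ (((1 : ℝ) / 2) • ((fun κ u κ' u' => (cE₂ * (Lc : ℝ) ^ (2 * (d + 1))) • mmRead Lc (K3OfK (unitK (sfStep Lc l) (smStep d Lc l) (coDressKBmAt (toSite r) Lc (KInvStep (d := d) Lc l))) Lc (unitS (sfStep Lc l) (smStep d Lc l) (SpureRecAt d Lc (toSite r) cE cVH cΛ l)) (unitM (sfStep Lc l) (smStep d Lc l) (M1At d Lc (toSite r) cΛ l)) (W2SymOfK (unitK (sfStep Lc l) (smStep d Lc l) (coDressKBmAt (toSite r) Lc (KInvStep (d := d) Lc l))) Lc (unitS (sfStep Lc l) (smStep d Lc l) (SpureRecAt d Lc (toSite r) cE cVH cΛ l)) (unitM (sfStep Lc l) (smStep d Lc l) (M1At d Lc (toSite r) cΛ l)) 0 (unitM₂ (sfStep Lc l) (smStep d Lc l) (M2Of d Lc (mixFFAt (toSite r) Lc) l))) κ u κ' u') + cB • vh₂S κ u κ' u') +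 ε • fun κ u κ' u' => sgnK (trK (((fun κ u κ' u' => (cE₂ * (Lc : ℝ) ^ (2 * (d + 1))) • mmRead Lc (K3OfK (unitK (sfStep Lc l) (smStep d Lc l) (coDressKBmAt (toSite r) Lc (KInvStep (d := d) Lc l))) Lc (unitS (sfStep Lc l) (smStep d Lc l) (SpureRecAt d Lc (toSite r) cE cVH cΛ l)) (unitM (sfStep Lc l) (smStep d Lc l) (M1At d Lc (toSite r) cΛ l)) (W2SymOfK (unitK (sfStep Lc l) (smStep d Lc l) (coDressKBmAt (toSite r) Lc (KInvStep (d := d) Lc l))) Lc (unitS (sfStep Lc l) (smStep d Lc l) (SpureRecAt d Lc (toSite r) cE cVH cΛ l)) (unitM (sfStep Lc l) (smStep d Lc l) (M1At d Lc (toSite r) cΛ l)) 0 (unitM₂ (sfStep Lc l) (smStep d Lc l) (M2Of d Lc (mixFFAt (toSite r) Lc) l))) κ u κ' u') + cB • vh₂S κ u κ' u')) κ u κ' u')))) C δ := by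
  obtain ⟨C, δ, hδ, h⟩ := exists_locStencil₂_source_comb hLc hr cE cVH cΛ cE₂ cB Tc hBff hBmm hB l
  exact ⟨C, δ, hδ, fun κ u κ' u' => (locStencil₂_half h hε) κ u κ' u'⟩

/-- NOT IN PRINT; OUR BOOKKEEPING.  **(HSP) DISCHARGED: THE SOURCE LEG LETTERS `rdiv ∘ F^ε_l` OF THE `ε`-MEMBER ARE IN THE RULED CLASS AT EVERY LEVEL** (`|ε| ≤ 1`;
border rows displayed): `halfSource_translate` ⨾ `exists_locStencil₂_halfSource` ⨾ FILE 8b's `legLetter_mem_ruledClass`. -/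
theorem halfSource_legLetter_mem (hLc : 1 ≤ Lc) (hr : r ∈ box (d + 1) Lc) (cE cVH cΛ cE₂ cB : ℝ) (Tc : Fin 4 → Fin 4 → Fin 4 → Fin 4 → ℝ) {vh₂S : (Fin (d + 1) → (Fin (d + 1) → ℤ) → Fin (d + 1) → (Fin (d + 1) → ℤ) → MKer (d + 1) (Fib d))}
    (hBff : ∀ κ u κ' u' x z (α β : Fin (d + 1)), vh₂S κ u κ' u' x z (Sum.inl α) (Sum.inl β) = 0)
    (hBmm : ∀ κ u κ' u' x z (μ ν : Fin (d + 1)), vh₂S κ u κ' u' x z (Sum.inr μ) (Sum.inr ν) = 0)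
    (hB : ∃ C δ : ℝ, 0 < δ ∧ LocStencil₂ vh₂S C δ)
    (hBt : ∀ (κ : Fin (d + 1)) (u : Fin (d + 1) → ℤ) (κ' : Fin (d + 1)) (u' t : Fin (d + 1) → ℤ),
        vh₂S κ (u + (Lc : ℤ) • t) κ' (u' + (Lc : ℤ) • t) = shiftK (-((Lc : ℤ) • t)) (vh₂S κ u κ' u')) {ε : ℝ} (hε : |ε| ≤ 1) (l : ℕ) :
    (fun W : (Fin (d + 1) → (Fin (d + 1) → ℤ) → Fin (d + 1) → (Fin (d + 1) → ℤ) → MKer (d + 1) (Fib d)) =>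
      (∀ (κ : Fin (d + 1)) (u : Fin (d + 1) → ℤ) (κ' : Fin (d + 1)) (u' t : Fin (d + 1) → ℤ),
          W κ (u + (Lc : ℤ) • t) κ' (u' + (Lc : ℤ) • t) = shiftK (-((Lc : ℤ) • t)) (W κ u κ' u')) ∧
      (∀ (N' : ℕ) (κ κ' : Fin (d + 1)) (a b : Fib d), zmode N' W κ κ' a b = 0) ∧
      (∃ C' δ' : ℝ, 0 < δ' ∧ LocStencil₂ W C' δ'))
      (fun κ u κ' u' => rdiv ((((1 : ℝ) / 2) • ((fun κ u κ' u' => (cE₂ * (Lc : ℝ) ^ (2 * (d + 1))) • mmRead Lc (K3OfK (unitK (sfStep Lc l) (smStep d Lc l) (coDressKBmAt (toSite r) Lc (KInvStep (d := d) Lc l))) Lc (unitS (sfStep Lc l) (smStep d Lc l) (SpureRecAt d Lc (toSite r) cE cVH cΛ l)) (unitM (sfStep Lc l) (smStep d Lc l) (M1At d Lc (toSite r) cΛ l)) (W2SymOfK (unitK (sfStep Lc l) (smStep d Lc l) (coDressKBmAt (toSite r) Lc (KInvStep (d := d) Lc l))) Lc (unitS (sfStep Lc l) (smStep d Lc l)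 (SpureRecAt d Lc (toSite r) cE cVH cΛ l)) (unitM (sfStep Lc l) (smStep d Lc l) (M1At d Lc (toSite r) cΛ l)) 0 (unitM₂ (sfStep Lc l) (smStep d Lc l) (M2Of d Lc (mixFFAt (toSite r) Lc) l))) κ u κ' u') + cB • vh₂S κ u κ' u') + ε • fun κ u κ' u' => sgnK (trK (((fun κ u κ' u' => (cE₂ * (Lc : ℝ) ^ (2 * (d + 1))) • mmRead Lc (K3OfK (unitK (sfStep Lc l) (smStep d Lc l) (coDressKBmAt (toSite r) Lc (KInvStep (d := d) Lc l))) Lc (unitS (sfStep Lc l) (smStep d Lc l) (SpureRecAt d Lc (toSite r) cE cVH cΛ l)) (unitM (sfStep Lc l) (smStep d Lc l) (M1At d Lc (toSite r) cΛ l)) (W2SymOfK (unitK (sfStep Lc l) (smStep d Lc l) (coDressKBmAt (toSite r) Lc (KInvStep (d := d) Lc l))) Lc (unitS (sfStep Lc l) (smStep d Lc l) (SpureRecAt d Lc (toSite r) cE cVH cΛ l)) (unitM (sfStep Lc l) (smStep d Lc l) (M1At d Lc (toSite r) cΛ l)) 0 (unitM₂ (sfStep Lc l) (smStep d Lc l)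 (M2Of d Lc (mixFFAt (toSite r) Lc) l))) κ u κ' u') + cB • vh₂S κ u κ' u')) κ u κ' u')))) κ u κ' u')) := by
  obtain ⟨C, δ, hδ, h⟩ := exists_locStencil₂_halfSource hLc hr cE cVH cΛ cE₂ cB Tc hBff hBmm hB hε l
  exact legLetter_mem_ruledClass (halfSource_translate hLc hr cE cVH cΛ cE₂ cB Tc hBff hBmm hB hBt ε l) h hδ

/-- [folklore] **A RAW LETTER ROW GIVES THE (HS)-SHAPED ROW OF FILE 4**: `LocStencil₂ X C δ` (`0 ≤ δ`, `|ε| ≤ 1`) ⟹ `LocStencil₂ (rdiv ∘ ½•(X + ε•P X)) ((d+1)(e^δ+1)·C) δ`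
(the OWNER's `locStencil₂_half` ⨾ MY FILE 6 `locStencil₂_rdiv`), so the source letter rows of p2 ∕ an2 feed FILE 4's (HS)∕(HS′) directly. -/
theorem locStencil₂_rdiv_half {X : (Fin (d + 1) → (Fin (d + 1) → ℤ) → Fin (d + 1) → (Fin (d + 1) → ℤ) → MKer (d + 1) (Fib d))} {C δ : ℝ} (h : LocStencil₂ X C δ) (hδ : 0 ≤ δ)
    {ε : ℝ} (hε : |ε| ≤ 1) :
    LocStencil₂ (fun κ u κ' u' => rdiv ((((1 : ℝ) / 2) • (X + ε • fun κ u κ' u' => sgnK (trK (X κ u κ' u')))) κ u κ' u'))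
      (((d + 1 : ℕ) : ℝ) * (Real.exp δ + 1) * C) δ :=
  locStencil₂_rdiv (X := ((1 : ℝ) / 2) • (X + ε • fun κ u κ' u' => sgnK (trK (X κ u κ' u')))) (fun κ u κ' u' => (locStencil₂_half h hε) κ u κ' u') hδ

/-! ## §3 The drift socket's difference sources are in the ruled class -/

/-- NOT IN PRINT; OUR BOOKKEEPING.  **FILE 2's `hSP` DISCHARGED: THE DIFFERENCE SOURCE OF THE DRIFT SOCKET IS IN THE RULED CLASS AT EVERY LEVEL** (`|ε| ≤ 1`; border rows
displayed): `(legStepB … (l+1) − legStepB … l)(rdiv ∘ y_l) + (rdiv ∘ F^ε_{l+1} − rdiv ∘ F^ε_l) ∈ 𝒫` — `legStepB_rdiv_mem` at the steps `l+1` and `l` on the member `y_l`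
(covariant by FILE 8b's `halfMember_translate`, `LocStencil₂` by `exists_locStencil₂_unitS₂_T2RecAt` ⨾ `locStencil₂_half`), `halfSource_legLetter_mem` at `l+1` and `l`, and the
closure rows `ruledClass_sub ∕ ruledClass_add`. -/
theorem halfDiffSource_mem (hLc : 1 ≤ Lc) (hr : r ∈ box (d + 1) Lc) (cE cVH cΛ cE₂ cB : ℝ) (Tc : Fin 4 → Fin 4 → Fin 4 → Fin 4 → ℝ) {vh₂S : (Fin (d + 1) → (Fin (d + 1) → ℤ) → Fin (d + 1) → (Fin (d + 1) → ℤ) → MKer (d + 1) (Fib d))}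
    (hBff : ∀ κ u κ' u' x z (α β : Fin (d + 1)), vh₂S κ u κ' u' x z (Sum.inl α) (Sum.inl β) = 0)
    (hBmm : ∀ κ u κ' u' x z (μ ν : Fin (d + 1)), vh₂S κ u κ' u' x z (Sum.inr μ) (Sum.inr ν) = 0)
    (hB : ∃ C δ : ℝ, 0 < δ ∧ LocStencil₂ vh₂S C δ)
    (hBt : ∀ (κ : Fin (d + 1)) (u : Fin (d + 1) → ℤ) (κ' : Fin (d + 1)) (u' t : Fin (d + 1) → ℤ),
        vh₂S κ (u + (Lc : ℤ) • t) κ' (u' + (Lc : ℤ) • t) = shiftK (-((Lc : ℤ) • t)) (vh₂S κ u κ' u')) {ε : ℝ} (hε : |ε| ≤ 1) (l : ℕ) :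
    (fun W : (Fin (d + 1) → (Fin (d + 1) → ℤ) → Fin (d + 1) → (Fin (d + 1) → ℤ) → MKer (d + 1) (Fib d)) =>
      (∀ (κ : Fin (d + 1)) (u : Fin (d + 1) → ℤ) (κ' : Fin (d + 1)) (u' t : Fin (d + 1) → ℤ),
          W κ (u + (Lc : ℤ) • t) κ' (u' + (Lc : ℤ) • t) = shiftK (-((Lc : ℤ) • t)) (W κ u κ' u')) ∧
      (∀ (N' : ℕ) (κ κ' : Fin (d + 1)) (a b : Fib d), zmode N' W κ κ' a b = 0) ∧
      (∃ C' δ' : ℝ, 0 < δ' ∧ LocStencil₂ W C' δ'))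
      ((legStepB (fun _ : ℕ => -((cE₂ * (Lc : ℝ) ^ (2 * (d + 1))) * ((Lc : ℝ) ^ (d + 1))⁻¹)) (fun m => unitK (sfStep Lc m) (smStep d Lc m) (coDressKBmAt (toSite r) Lc (KInvStep (d := d) Lc m))) Lc (l + 1) (fun κ u κ' u' => rdiv ((((1 : ℝ) / 2) • (unitS₂ (sfStep Lc l) (smStep d Lc l) (T2RecAt d Lc (toSite r) cE cVH cΛ cE₂ cB Tc vh₂S (mixFFAt (toSite r) Lc) l) + ε • fun κ u κ' u' => sgnK (trK ((unitS₂ (sfStep Lc l) (smStep d Lc l) (T2RecAt d Lc (toSite r) cE cVH cΛ cE₂ cB Tc vh₂S (mixFFAt (toSite r) Lc) l)) κ u κ' u')))) κ u κ' u'))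
          - legStepB (fun _ : ℕ => -((cE₂ * (Lc : ℝ) ^ (2 * (d + 1))) * ((Lc : ℝ) ^ (d + 1))⁻¹)) (fun m => unitK (sfStep Lc m) (smStep d Lc m) (coDressKBmAt (toSite r) Lc (KInvStep (d := d) Lc m))) Lc l (fun κ u κ' u' => rdiv ((((1 : ℝ) / 2) • (unitS₂ (sfStep Lc l) (smStep d Lc l) (T2RecAt d Lc (toSite r) cE cVH cΛ cE₂ cB Tc vh₂S (mixFFAt (toSite r) Lc) l) + ε • fun κ u κ' u' => sgnK (trK ((unitS₂ (sfStep Lc l) (smStep d Lc l) (T2RecAt d Lc (toSite r) cE cVH cΛ cE₂ cB Tc vh₂S (mixFFAt (toSite r) Lc) l)) κ u κ' u')))) κ u κ' u')))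
        + ((fun κ u κ' u' => rdiv ((((1 : ℝ) / 2) • ((fun κ u κ' u' => (cE₂ * (Lc : ℝ) ^ (2 * (d + 1))) • mmRead Lc (K3OfK (unitK (sfStep Lc (l + 1)) (smStep d Lc (l + 1)) (coDressKBmAt (toSite r) Lc (KInvStep (d := d) Lc (l + 1)))) Lc (unitS (sfStep Lc (l + 1)) (smStep d Lc (l + 1)) (SpureRecAt d Lc (toSite r) cE cVH cΛ (l + 1))) (unitM (sfStep Lc (l + 1)) (smStep d Lc (l + 1)) (M1At d Lc (toSite r) cΛ (l + 1))) (W2SymOfK (unitK (sfStep Lc (l + 1)) (smStep d Lc (l + 1)) (coDressKBmAt (toSite r) Lc (KInvStep (d := d) Lc (l + 1)))) Lc (unitS (sfStep Lc (l + 1)) (smStep d Lc (l + 1)) (SpureRecAt d Lc (toSite r) cE cVH cΛ (l + 1))) (unitM (sfStep Lc (l + 1)) (smStep d Lc (l + 1)) (M1At d Lc (toSite r) cΛ (l + 1))) 0 (unitM₂ (sfStep Lc (l + 1)) (smStep d Lc (l + 1)) (M2Of d Lc (mixFFAt (toSite r) Lc) (l + 1)))) κ u κ' u') + cB • vh₂S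 κ u κ' u') + ε • fun κ u κ' u' => sgnK (trK (((fun κ u κ' u' => (cE₂ * (Lc : ℝ) ^ (2 * (d + 1))) • mmRead Lc (K3OfK (unitK (sfStep Lc (l + 1)) (smStep d Lc (l + 1)) (coDressKBmAt (toSite r) Lc (KInvStep (d := d) Lc (l + 1)))) Lc (unitS (sfStep Lc (l + 1)) (smStep d Lc (l + 1)) (SpureRecAt d Lc (toSite r) cE cVH cΛ (l + 1))) (unitM (sfStep Lc (l + 1)) (smStep d Lc (l + 1)) (M1At d Lc (toSite r) cΛ (l + 1))) (W2SymOfK (unitK (sfStep Lc (l + 1)) (smStep d Lc (l + 1)) (coDressKBmAt (toSite r) Lc (KInvStep (d := d) Lc (l + 1)))) Lc (unitS (sfStep Lc (l + 1)) (smStep d Lc (l + 1)) (SpureRecAt d Lc (toSite r) cE cVH cΛ (l + 1))) (unitM (sfStep Lc (l + 1)) (smStep d Lc (l + 1)) (M1At d Lc (toSite r) cΛ (l + 1))) 0 (unitM₂ (sfStep Lc (l + 1)) (smStep d Lc (l + 1)) (M2Of d Lc (mixFFAt (toSite r) Lc) (l + 1)))) κ u κ' u') + cB • vh₂S κ u κ'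 u')) κ u κ' u')))) κ u κ' u')) - fun κ u κ' u' => rdiv ((((1 : ℝ) / 2) • ((fun κ u κ' u' => (cE₂ * (Lc : ℝ) ^ (2 * (d + 1))) • mmRead Lc (K3OfK (unitK (sfStep Lc l) (smStep d Lc l) (coDressKBmAt (toSite r) Lc (KInvStep (d := d) Lc l))) Lc (unitS (sfStep Lc l) (smStep d Lc l) (SpureRecAt d Lc (toSite r) cE cVH cΛ l)) (unitM (sfStep Lc l) (smStep d Lc l) (M1At d Lc (toSite r) cΛ l)) (W2SymOfK (unitK (sfStep Lc l) (smStep d Lc l) (coDressKBmAt (toSite r) Lc (KInvStep (d := d) Lc l))) Lc (unitS (sfStep Lc l) (smStep d Lc l) (SpureRecAt d Lc (toSite r) cE cVH cΛ l)) (unitM (sfStep Lc l) (smStep d Lc l) (M1At d Lc (toSite r) cΛ l)) 0 (unitM₂ (sfStep Lc l) (smStep d Lc l) (M2Of d Lc (mixFFAt (toSite r) Lc) l))) κ u κ' u') + cB • vh₂S κ u κ' u') + ε • fun κ u κ' u' => sgnK (trK (((fun κ u κ' u' => (cE₂ * (Lc : ℝ) ^ (2 * (d + 1))) • mmRead Lc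 (K3OfK (unitK (sfStep Lc l) (smStep d Lc l) (coDressKBmAt (toSite r) Lc (KInvStep (d := d) Lc l))) Lc (unitS (sfStep Lc l) (smStep d Lc l) (SpureRecAt d Lc (toSite r) cE cVH cΛ l)) (unitM (sfStep Lc l) (smStep d Lc l) (M1At d Lc (toSite r) cΛ l)) (W2SymOfK (unitK (sfStep Lc l) (smStep d Lc l) (coDressKBmAt (toSite r) Lc (KInvStep (d := d) Lc l))) Lc (unitS (sfStep Lc l) (smStep d Lc l) (SpureRecAt d Lc (toSite r) cE cVH cΛ l)) (unitM (sfStep Lc l) (smStep d Lc l) (M1At d Lc (toSite r) cΛ l)) 0 (unitM₂ (sfStep Lc l) (smStep d Lc l) (M2Of d Lc (mixFFAt (toSite r) Lc) l))) κ u κ' u') + cB • vh₂S κ u κ' u')) κ u κ' u')))) κ u κ' u'))) := by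
  obtain ⟨Cn, δn, hδn, hn⟩ := exists_locStencil₂_unitS₂_T2RecAt hLc hr cE cVH cΛ cE₂ cB Tc hB l
  have hyl : LocStencil₂ (((1 : ℝ) / 2) • (unitS₂ (sfStep Lc l) (smStep d Lc l) (T2RecAt d Lc (toSite r) cE cVH cΛ cE₂ cB Tc vh₂S (mixFFAt (toSite r) Lc) l) + ε • fun κ u κ' u' => sgnK (trK ((unitS₂ (sfStep Lc l) (smStep d Lc l) (T2RecAt d Lc (toSite r) cE cVH cΛ cE₂ cB Tc vh₂S (mixFFAt (toSite r) Lc) l)) κ u κ' u')))) Cn δn := fun κ u κ' u' => (locStencil₂_half hn hε) κ u κ' u'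
  have hyc := halfMember_translate (r := r) hLc cE cVH cΛ cE₂ cB Tc hBt ε l
  exact ruledClass_add
    (ruledClass_sub (legStepB_rdiv_mem hr (cE₂ * (Lc : ℝ) ^ (2 * (d + 1))) (l + 1) hyc hyl hδn)
      (legStepB_rdiv_mem hr (cE₂ * (Lc : ℝ) ^ (2 * (d + 1))) l hyc hyl hδn))
    (ruledClass_sub (halfSource_legLetter_mem hLc hr cE cVH cΛ cE₂ cB Tc hBff hBmm hB hBt hε (l + 1))
      (halfSource_legLetter_mem hLc hr cE cVH cΛ cE₂ cB Tc hBff hBmm hB hBt hε l))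

/-- NOT IN PRINT; OUR BOOKKEEPING.  **FILE 2's `hKP`: THE KERNEL-DRIFT LETTER OF THE `ε`-MEMBER IS IN THE RULED CLASS AT EVERY LEVEL** (`|ε| ≤ 1`; border rows displayed):
`legStepB … (l+1) (rdiv ∘ y_l) − legStepB … l (rdiv ∘ y_l) ∈ 𝒫` — `legStepB_rdiv_mem` at the steps `l+1` and `l` on the member, `ruledClass_sub`. -/
theorem halfKernelDrift_mem (hLc : 1 ≤ Lc) (hr : r ∈ box (d + 1) Lc) (cE cVH cΛ cE₂ cB : ℝ) (Tc : Fin 4 → Fin 4 → Fin 4 → Fin 4 → ℝ) {vh₂S : (Fin (d + 1) → (Fin (d + 1) → ℤ) → Fin (d + 1) → (Fin (d + 1) → ℤ) → MKer (d + 1) (Fib d))}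
    (hB : ∃ C δ : ℝ, 0 < δ ∧ LocStencil₂ vh₂S C δ)
    (hBt : ∀ (κ : Fin (d + 1)) (u : Fin (d + 1) → ℤ) (κ' : Fin (d + 1)) (u' t : Fin (d + 1) → ℤ),
        vh₂S κ (u + (Lc : ℤ) • t) κ' (u' + (Lc : ℤ) • t) = shiftK (-((Lc : ℤ) • t)) (vh₂S κ u κ' u')) {ε : ℝ} (hε : |ε| ≤ 1) (l : ℕ) :
    (fun W : (Fin (d + 1) → (Fin (d + 1) → ℤ) → Fin (d + 1) → (Fin (d + 1) → ℤ) → MKer (d + 1) (Fib d)) =>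
      (∀ (κ : Fin (d + 1)) (u : Fin (d + 1) → ℤ) (κ' : Fin (d + 1)) (u' t : Fin (d + 1) → ℤ),
          W κ (u + (Lc : ℤ) • t) κ' (u' + (Lc : ℤ) • t) = shiftK (-((Lc : ℤ) • t)) (W κ u κ' u')) ∧
      (∀ (N' : ℕ) (κ κ' : Fin (d + 1)) (a b : Fib d), zmode N' W κ κ' a b = 0) ∧
      (∃ C' δ' : ℝ, 0 < δ' ∧ LocStencil₂ W C' δ'))
      (legStepB (fun _ : ℕ => -((cE₂ * (Lc : ℝ) ^ (2 * (d + 1))) * ((Lc : ℝ) ^ (d + 1))⁻¹)) (fun m => unitK (sfStep Lc m) (smStep d Lc m) (coDressKBmAt (toSite r) Lc (KInvStep (d := d) Lc m))) Lc (l + 1) (fun κ u κ' u' => rdiv ((((1 : ℝ) / 2) • (unitS₂ (sfStep Lc l) (smStep d Lc l) (T2RecAt d Lc (toSite r) cE cVH cΛ cE₂ cB Tc vh₂S (mixFFAt (toSite r) Lc) l) + ε • fun κ u κ' u' => sgnK (trK ((unitS₂ (sfStep Lc l) (smStep d Lc l) (T2RecAt d Lc (toSite r) cE cVH cΛ cE₂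 cB Tc vh₂S (mixFFAt (toSite r) Lc) l)) κ u κ' u')))) κ u κ' u'))
        - legStepB (fun _ : ℕ => -((cE₂ * (Lc : ℝ) ^ (2 * (d + 1))) * ((Lc : ℝ) ^ (d + 1))⁻¹)) (fun m => unitK (sfStep Lc m) (smStep d Lc m) (coDressKBmAt (toSite r) Lc (KInvStep (d := d) Lc m))) Lc l (fun κ u κ' u' => rdiv ((((1 : ℝ) / 2) • (unitS₂ (sfStep Lc l) (smStep d Lc l) (T2RecAt d Lc (toSite r) cE cVH cΛ cE₂ cB Tc vh₂S (mixFFAt (toSite r) Lc) l) + ε • fun κ u κ' u' => sgnK (trK ((unitS₂ (sfStep Lc l) (smStep d Lc l) (T2RecAt d Lc (toSite r) cE cVH cΛ cE₂ cB Tc vh₂S (mixFFAt (toSite r) Lc) l)) κ u κ' u')))) κ u κ' u'))) := by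
  obtain ⟨Cn, δn, hδn, hn⟩ := exists_locStencil₂_unitS₂_T2RecAt hLc hr cE cVH cΛ cE₂ cB Tc hB l
  have hyl : LocStencil₂ (((1 : ℝ) / 2) • (unitS₂ (sfStep Lc l) (smStep d Lc l) (T2RecAt d Lc (toSite r) cE cVH cΛ cE₂ cB Tc vh₂S (mixFFAt (toSite r) Lc) l) + ε • fun κ u κ' u' => sgnK (trK ((unitS₂ (sfStep Lc l) (smStep d Lc l) (T2RecAt d Lc (toSite r) cE cVH cΛ cE₂ cB Tc vh₂S (mixFFAt (toSite r) Lc) l)) κ u κ' u')))) Cn δn := fun κ u κ' u' => (locStencil₂_half hn hε) κ u κ' u'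
  have hyc := halfMember_translate (r := r) hLc cE cVH cΛ cE₂ cB Tc hBt ε l
  exact ruledClass_sub (legStepB_rdiv_mem hr (cE₂ * (Lc : ℝ) ^ (2 * (d + 1))) (l + 1) hyc hyl hδn)
    (legStepB_rdiv_mem hr (cE₂ * (Lc : ℝ) ^ (2 * (d + 1))) l hyc hyl hδn)

/-- NOT IN PRINT; OUR BOOKKEEPING.  **FILE 2's `hSP`: THE SOURCE-DRIFT LETTER OF THE `ε`-MEMBER IS IN THE RULED CLASS AT EVERY LEVEL** (`|ε| ≤ 1`; border rows displayed):
`rdiv ∘ F^ε_{l+1} − rdiv ∘ F^ε_l ∈ 𝒫` — `halfSource_legLetter_mem` at `l+1` and `l`, `ruledClass_sub`. -/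
theorem halfSourceDrift_mem (hLc : 1 ≤ Lc) (hr : r ∈ box (d + 1) Lc) (cE cVH cΛ cE₂ cB : ℝ) (Tc : Fin 4 → Fin 4 → Fin 4 → Fin 4 → ℝ) {vh₂S : (Fin (d + 1) → (Fin (d + 1) → ℤ) → Fin (d + 1) → (Fin (d + 1) → ℤ) → MKer (d + 1) (Fib d))}
    (hBff : ∀ κ u κ' u' x z (α β : Fin (d + 1)), vh₂S κ u κ' u' x z (Sum.inl α) (Sum.inl β) = 0)
    (hBmm : ∀ κ u κ' u' x z (μ ν : Fin (d + 1)), vh₂S κ u κ' u' x z (Sum.inr μ) (Sum.inr ν) = 0)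
    (hB : ∃ C δ : ℝ, 0 < δ ∧ LocStencil₂ vh₂S C δ)
    (hBt : ∀ (κ : Fin (d + 1)) (u : Fin (d + 1) → ℤ) (κ' : Fin (d + 1)) (u' t : Fin (d + 1) → ℤ),
        vh₂S κ (u + (Lc : ℤ) • t) κ' (u' + (Lc : ℤ) • t) = shiftK (-((Lc : ℤ) • t)) (vh₂S κ u κ' u')) {ε : ℝ} (hε : |ε| ≤ 1) (l : ℕ) :
    (fun W : (Fin (d + 1) → (Fin (d + 1) → ℤ) → Fin (d + 1) → (Fin (d + 1) → ℤ) → MKer (d + 1) (Fib d)) =>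
      (∀ (κ : Fin (d + 1)) (u : Fin (d + 1) → ℤ) (κ' : Fin (d + 1)) (u' t : Fin (d + 1) → ℤ),
          W κ (u + (Lc : ℤ) • t) κ' (u' + (Lc : ℤ) • t) = shiftK (-((Lc : ℤ) • t)) (W κ u κ' u')) ∧
      (∀ (N' : ℕ) (κ κ' : Fin (d + 1)) (a b : Fib d), zmode N' W κ κ' a b = 0) ∧
      (∃ C' δ' : ℝ, 0 < δ' ∧ LocStencil₂ W C' δ'))
      ((fun κ u κ' u' => rdiv ((((1 : ℝ) / 2) • ((fun κ u κ' u' => (cE₂ * (Lc : ℝ) ^ (2 * (d + 1))) • mmRead Lc (K3OfK (unitK (sfStep Lc (l + 1)) (smStep d Lc (l + 1)) (coDressKBmAt (toSite r) Lc (KInvStep (d := d) Lc (l + 1)))) Lc (unitS (sfStep Lc (l + 1)) (smStep d Lc (l + 1)) (SpureRecAt d Lc (toSite r) cE cVH cΛ (l + 1))) (unitM (sfStep Lc (l + 1)) (smStep d Lc (l + 1)) (M1At d Lc (toSite r) cΛ (l + 1))) (W2SymOfK (unitK (sfStep Lc (l + 1)) (smStep d Lc (l + 1)) (coDressKBmAt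 (toSite r) Lc (KInvStep (d := d) Lc (l + 1)))) Lc (unitS (sfStep Lc (l + 1)) (smStep d Lc (l + 1)) (SpureRecAt d Lc (toSite r) cE cVH cΛ (l + 1))) (unitM (sfStep Lc (l + 1)) (smStep d Lc (l + 1)) (M1At d Lc (toSite r) cΛ (l + 1))) 0 (unitM₂ (sfStep Lc (l + 1)) (smStep d Lc (l + 1)) (M2Of d Lc (mixFFAt (toSite r) Lc) (l + 1)))) κ u κ' u') + cB • vh₂S κ u κ' u') + ε • fun κ u κ' u' => sgnK (trK (((fun κ u κ' u' => (cE₂ * (Lc : ℝ) ^ (2 * (d + 1))) • mmRead Lc (K3OfK (unitK (sfStep Lc (l + 1)) (smStep d Lc (l + 1)) (coDressKBmAt (toSite r) Lc (KInvStep (d := d) Lc (l + 1)))) Lc (unitS (sfStep Lc (l + 1)) (smStep d Lc (l + 1)) (SpureRecAt d Lc (toSite r) cE cVH cΛ (l + 1))) (unitM (sfStep Lc (l + 1)) (smStep d Lc (l + 1)) (M1At d Lc (toSite r) cΛ (l + 1))) (W2SymOfK (unitK (sfStep Lc (l + 1)) (smStep d Lc (l + 1)) (coDressKBmAt (toSite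 r) Lc (KInvStep (d := d) Lc (l + 1)))) Lc (unitS (sfStep Lc (l + 1)) (smStep d Lc (l + 1)) (SpureRecAt d Lc (toSite r) cE cVH cΛ (l + 1))) (unitM (sfStep Lc (l + 1)) (smStep d Lc (l + 1)) (M1At d Lc (toSite r) cΛ (l + 1))) 0 (unitM₂ (sfStep Lc (l + 1)) (smStep d Lc (l + 1)) (M2Of d Lc (mixFFAt (toSite r) Lc) (l + 1)))) κ u κ' u') + cB • vh₂S κ u κ' u')) κ u κ' u')))) κ u κ' u')) - fun κ u κ' u' => rdiv ((((1 : ℝ) / 2) • ((fun κ u κ' u' => (cE₂ * (Lc : ℝ) ^ (2 * (d + 1))) • mmRead Lc (K3OfK (unitK (sfStep Lc l) (smStep d Lc l) (coDressKBmAt (toSite r) Lc (KInvStep (d := d) Lc l))) Lc (unitS (sfStep Lc l) (smStep d Lc l) (SpureRecAt d Lc (toSite r) cE cVH cΛ l)) (unitM (sfStep Lc l) (smStep d Lc l) (M1At d Lc (toSite r) cΛ l)) (W2SymOfK (unitK (sfStep Lc l) (smStep d Lc l) (coDressKBmAt (toSite r) Lc (KInvStep (d := d) Lc l))) Lc (unitS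 (sfStep Lc l) (smStep d Lc l) (SpureRecAt d Lc (toSite r) cE cVH cΛ l)) (unitM (sfStep Lc l) (smStep d Lc l) (M1At d Lc (toSite r) cΛ l)) 0 (unitM₂ (sfStep Lc l) (smStep d Lc l) (M2Of d Lc (mixFFAt (toSite r) Lc) l))) κ u κ' u') + cB • vh₂S κ u κ' u') + ε • fun κ u κ' u' => sgnK (trK (((fun κ u κ' u' => (cE₂ * (Lc : ℝ) ^ (2 * (d + 1))) • mmRead Lc (K3OfK (unitK (sfStep Lc l) (smStep d Lc l) (coDressKBmAt (toSite r) Lc (KInvStep (d := d) Lc l))) Lc (unitS (sfStep Lc l) (smStep d Lc l) (SpureRecAt d Lc (toSite r) cE cVH cΛ l)) (unitM (sfStep Lc l) (smStep d Lc l) (M1At d Lc (toSite r) cΛ l)) (W2SymOfK (unitK (sfStep Lc l) (smStep d Lc l) (coDressKBmAt (toSite r) Lc (KInvStep (d := d) Lc l))) Lc (unitS (sfStep Lc l) (smStep d Lc l) (SpureRecAt d Lc (toSite r) cE cVH cΛ l)) (unitM (sfStep Lc l) (smStep d Lc l) (M1At d Lc (toSite r) cΛ l)) 0 (unitM₂ (sfStep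 Lc l) (smStep d Lc l) (M2Of d Lc (mixFFAt (toSite r) Lc) l))) κ u κ' u') + cB • vh₂S κ u κ' u')) κ u κ' u')))) κ u κ' u')) :=
  ruledClass_sub (halfSource_legLetter_mem hLc hr cE cVH cΛ cE₂ cB Tc hBff hBmm hB hBt hε (l + 1))
    (halfSource_legLetter_mem hLc hr cE cVH cΛ cE₂ cB Tc hBff hBmm hB hBt hε l)

end Summit.QuantumFields.BalabanUV.Beta.GAN24.LegSourceRuledClass
end
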